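import Mathlib
import HarnessLib
import Summits.HubbardSuperconductivity.HubbardSuperconductivity.Theorems.KLProgrammeKLRegimeSplitTwoLegStepE
import Summits.HubbardSuperconductivity.HubbardSuperconductivity.Theorems.KLProgrammeKLRegimeCountertermV11Volume

/-!
# Route `KLProgramme` — crux K3: the COUNTERTERM child's hypothesis block, one-volume construction, volume transfer (PROVED) and composition,
# GENERIC IN THE ENGINE SLOT (`CtHypMsE E`, `CtOneVolumeMsE E`, `countertermP2_klPredsE_of_ms`)
# (seat hubbard-kl-k3c5-p1 g3; the `E`-generic twin of `…CountertermV11Volume` §2 over `…SplitTwoLegStepE`)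

`…CountertermV11Volume` §2 (gen 3, child `KLRegimeCountertermV11` = stmt-HubbardSuperconductivity-19825, CLOSED by k3c3-p2's wholesale continuation)
names the engine predicate `EngineBoundsAtV7S` and the slot `TwoLegStepV11` in its hypothesis block although neither the volume transfer nor the
composition ever looks inside the engine slot.  Gen 4 (Δ21) changes ONLY the engine slot (`PairLadderStepAtV7 → V8` inside `EngineBoundsAtV7S → V8S`).
This module re-types §2 over the `E`-generic slot/history/bundle of `…SplitTwoLegStepE` (`histE E`, `TwoLegStepE E`, `klPredsE E`):

* `CtHypMsE E G P Q β U μ Lh Mh` — the block (`CtHypMsV11 = CtHypMsE EngineBoundsAtV7S` by `rfl`);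
* `CtOneVolumeMsE E G P Q` — the one-volume construction (`CtOneVolumeMsV11 = CtOneVolumeMsE EngineBoundsAtV7S` by `rfl`);
* accessors `CtHypMsE.rateAntecedent/.hist/.engine/.split/.twoLegStepE/.twoLegStepG/.twoLegSizesMS/.twoLegAngularG/.volumeRate`;
* `ct_volumeTransferMsE` (PROVED, the strong induction of `ct_volumeTransferMsV11` verbatim);
* **`countertermP2_klPredsE_of_ms (E) : (∀ G P Q, WF → CtOneVolumeMsE E G P Q) → CountertermP2 (klPredsE E) klWindowC`** and its V11 instance
  `countertermP2_klPredsV11_of_ms'` (type-checks against `CountertermP2 klPredsV11 klWindowC` by `klPredsV11 = klPredsE EngineBoundsAtV7S`).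

So a bundle `klPredsV12 := klPredsE EngineBoundsAtV8S` (or any bundle typed in that shape) gets its counterterm child from `CtOneVolumeMsE EngineBoundsAtV8S`
alone, i.e. from the `E`-generic port of the continuation (`…CountertermContinuation` / `…CountertermOneVolumeMs`, whose proofs never read `E`).
Definitions + proofs; nothing is asserted about the Hubbard model.
-/

noncomputable section

namespace Summit.HubbardSuperconductivity.HubbardSuperconductivity.Theorems.KLRegimeSplit

set_option linter.dupNamespace false -- summit = problem name (single-conjunct summit), D-0017

open Real Finset Literature.MathematicalPhysics.QuantumLattice Literature.Probability.LatticeModels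
open Summit.HubbardSuperconductivity.HubbardSuperconductivity.Theorems.KLProgrammeLegKernels

/-! ## Child 2's hypothesis block, one-volume construction, volume transfer and composition — GENERIC IN THE ENGINE SLOT -/

section ModelE

/-- **Child 2's hypothesis block for the engine slot `E`** at `(G, P, Q, β, U, μ)` beyond thresholds `(Lh, Mh)`: every admissible frame (package
`ctRenMs G`), at every large volume and every scale, renormalised below the scale ⇒ the engine output `E`, the two-leg step `TwoLegStepE E` (incl.
(E3a-MS), (E3g) and the (E3f) rate) and the split `BetaSplitAtS2` at the scale.  `CtHypMsV11 = CtHypMsE EngineBoundsAtV7S` (`rfl`). -/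
def CtHypMsE (E : EngSlot) (G : GeoConsts) (P : SplitConsts) (Q : EngConsts) (β U μ : ℝ) (Lh : ℕ) (Mh : ℕ → ℕ) : Prop :=
  ∀ K : TrigPolyC4v, FrameOK (ctRenMs G) U (nScales β) μ K →
    ∀ (L M : ℕ) [NeZero L] [NeZero M], Lh ≤ L → Mh L ≤ M →
      ∀ n : ℕ, n ≤ nScales β → (∀ j < n, RenormalisedAtF L M β U μ K (ctRenMs G) j) →
        E L M G P Q β U μ K n ∧ TwoLegStepE L M E G P Q (ctRenMs G) β U μ K n ∧ BetaSplitAtS2 L M G P Q β U μ K n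

end ModelE

/-- **The ONE-VOLUME CONSTRUCTION for the engine slot `E`** (`CtOneVolumeMsV11`'s text over `CtHypMsE E`; `CtOneVolumeMsV11 = CtOneVolumeMsE
EngineBoundsAtV7S` by `rfl`): in the regime, from the block beyond `(Lh, Mh)` one builds at ONE volume `(L₀, M₀) ≥ (Lh, Mh L₀)`, `M₀ ≥ Q.M0 β L₀`, an
ADMISSIBLE frame whose local parts at `(L₀, M₀)` are within HALF the quadratic tolerance at every scale and angle, with `Q.CL β n / L₀` in the other half. -/
def CtOneVolumeMsE (E : EngSlot) (G : GeoConsts) (P : SplitConsts) (Q : EngConsts) : Prop :=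
    ∃ c₁ : ℝ, 0 < c₁ ∧ ∀ c : ℝ, 0 < c → c ≤ c₁ → ∃ U₀ : ℝ, 0 < U₀ ∧
      ∀ μ ∈ klWindowC, ∀ U : ℝ, 0 < U → U ≤ U₀ → ∀ β : ℝ, klBetaMin ≤ β → β ≤ Real.exp (c / U ^ 2) →
        ∀ (Lh : ℕ) (Mh : ℕ → ℕ), CtHypMsE E G P Q β U μ Lh Mh →
          ∃ K : TrigPolyC4v, FrameOK (ctRenMs G) U (nScales β) μ K ∧
            ∃ (L₀ M₀ : ℕ), 0 < L₀ ∧ 0 < M₀ ∧ Lh ≤ L₀ ∧ Mh L₀ ≤ M₀ ∧ Q.M0 β L₀ ≤ M₀ ∧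
              (∀ (_ : NeZero L₀) (_ : NeZero M₀), ∀ n : ℕ, n ≤ nScales β →
                (∀ θ : ℝ, |klLocalPart L₀ M₀ β U μ K n θ| ≤ ctCr G * |U| * klScale klE0 n ^ 2 / klE0 / 2) ∧
                Q.CL β n / L₀ ≤ ctCr G * |U| * klScale klE0 n ^ 2 / klE0 / 2)

/-- `CtHypMsV11 = CtHypMsE EngineBoundsAtV7S` (the V11 block IS the generic block at V11's engine slot). -/
theorem ctHypMsV11_eq_ctHypMsE (G : GeoConsts) (P : SplitConsts) (Q : EngConsts) (β U μ : ℝ) (Lh : ℕ) (Mh : ℕ → ℕ) :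
    CtHypMsV11 G P Q β U μ Lh Mh = CtHypMsE EngineBoundsAtV7S G P Q β U μ Lh Mh := rfl

/-- `CtOneVolumeMsV11 = CtOneVolumeMsE EngineBoundsAtV7S` (the registered stub of gen 3 IS the generic one-volume construction at V11's slot). -/
theorem ctOneVolumeMsV11_eq_ctOneVolumeMsE (G : GeoConsts) (P : SplitConsts) (Q : EngConsts) :
    CtOneVolumeMsV11 G P Q = CtOneVolumeMsE EngineBoundsAtV7S G P Q := rfl

section AccessorsE

variable {E : EngSlot} {G : GeoConsts} {P : SplitConsts} {Q : EngConsts} {β U μ : ℝ} {Lh : ℕ} {Mh : ℕ → ℕ}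

/-- **The block yields the full (E3f) comparison antecedent at any large volume carrying the renormalisation history**:
`histE E ∧ TwoLegStepG (histE E) ∧ TwoLegSizesMS ∧ TwoLegAngularG` below `n`. -/
theorem CtHypMsE.rateAntecedent (hyp : CtHypMsE E G P Q β U μ Lh Mh) {K : TrigPolyC4v} (hK : FrameOK (ctRenMs G) U (nScales β) μ K)
    {L M : ℕ} [NeZero L] [NeZero M] (hL : Lh ≤ L) (hM : Mh L ≤ M) {n : ℕ} (hn : n ≤ nScales β)
    (hren : ∀ j < n, RenormalisedAtF L M β U μ K (ctRenMs G) j) :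
    ∀ j < n, histE L M E G P Q (ctRenMs G) β U μ K j ∧
      TwoLegStepG L M (histE L M E G P Q (ctRenMs G) β U μ) G P Q (ctRenMs G) β U μ K j ∧
        TwoLegSizesMS L M G Q (ctRenMs G) β U μ K j ∧ TwoLegAngularG L M G Q (ctRenMs G) β U μ K j := by
  intro j hj
  have hs := hyp K hK L M hL hM j (le_of_lt (lt_of_lt_of_le hj hn)) fun i hi => hren i (hi.trans hj)
  exact ⟨⟨hs.2.2, hren j hj, hs.1⟩, hs.2.1.1, hs.2.1.2.1, hs.2.1.2.2.1⟩

/-- **The block yields the history `histE E` below the scale** for a frame renormalised below it (the comparison-frame input of (E3c-G)). -/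
theorem CtHypMsE.hist (hyp : CtHypMsE E G P Q β U μ Lh Mh) {K : TrigPolyC4v} (hK : FrameOK (ctRenMs G) U (nScales β) μ K)
    {L M : ℕ} [NeZero L] [NeZero M] (hL : Lh ≤ L) (hM : Mh L ≤ M) {n : ℕ} (hn : n ≤ nScales β)
    (hren : ∀ j < n, RenormalisedAtF L M β U μ K (ctRenMs G) j) :
    ∀ j < n, histE L M E G P Q (ctRenMs G) β U μ K j :=
  fun j hj => (hyp.rateAntecedent hK hL hM hn hren j hj).1

/-- **The block yields the engine output `E`** for renormalised frames. -/
theorem CtHypMsE.engine (hyp : CtHypMsE E G P Q β U μ Lh Mh) {K : TrigPolyC4v} (hK : FrameOK (ctRenMs G) U (nScales β) μ K)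
    {L M : ℕ} [NeZero L] [NeZero M] (hL : Lh ≤ L) (hM : Mh L ≤ M) {n : ℕ} (hn : n ≤ nScales β)
    (hren : ∀ j < n, RenormalisedAtF L M β U μ K (ctRenMs G) j) :
    E L M G P Q β U μ K n :=
  (hyp K hK L M hL hM n hn hren).1

/-- **The block yields the split `BetaSplitAtS2`** for renormalised frames. -/
theorem CtHypMsE.split (hyp : CtHypMsE E G P Q β U μ Lh Mh) {K : TrigPolyC4v} (hK : FrameOK (ctRenMs G) U (nScales β) μ K)
    {L M : ℕ} [NeZero L] [NeZero M] (hL : Lh ≤ L) (hM : Mh L ≤ M) {n : ℕ} (hn : n ≤ nScales β)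
    (hren : ∀ j < n, RenormalisedAtF L M β U μ K (ctRenMs G) j) :
    BetaSplitAtS2 L M G P Q β U μ K n :=
  (hyp K hK L M hL hM n hn hren).2.2

/-- **The block yields the two-leg slot `TwoLegStepE E`** for renormalised frames. -/
theorem CtHypMsE.twoLegStepE (hyp : CtHypMsE E G P Q β U μ Lh Mh) {K : TrigPolyC4v} (hK : FrameOK (ctRenMs G) U (nScales β) μ K)
    {L M : ℕ} [NeZero L] [NeZero M] (hL : Lh ≤ L) (hM : Mh L ≤ M) {n : ℕ} (hn : n ≤ nScales β)
    (hren : ∀ j < n, RenormalisedAtF L M β U μ K (ctRenMs G) j) :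
    TwoLegStepE L M E G P Q (ctRenMs G) β U μ K n :=
  (hyp K hK L M hL hM n hn hren).2.1

/-- **The block yields the «G» two-leg step for renormalised frames** (sizes, floor, frame-Lipschitz at the history `histE E`, slopes). -/
theorem CtHypMsE.twoLegStepG (hyp : CtHypMsE E G P Q β U μ Lh Mh) {K : TrigPolyC4v} (hK : FrameOK (ctRenMs G) U (nScales β) μ K)
    {L M : ℕ} [NeZero L] [NeZero M] (hL : Lh ≤ L) (hM : Mh L ≤ M) {n : ℕ} (hn : n ≤ nScales β)
    (hren : ∀ j < n, RenormalisedAtF L M β U μ K (ctRenMs G) j) :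
    TwoLegStepG L M (histE L M E G P Q (ctRenMs G) β U μ) G P Q (ctRenMs G) β U μ K n :=
  (hyp K hK L M hL hM n hn hren).2.1.1

/-- **The block yields (E3a-MS) for renormalised frames** (the multi-slot sizes — the self-map input of the wholesale continuation). -/
theorem CtHypMsE.twoLegSizesMS (hyp : CtHypMsE E G P Q β U μ Lh Mh) {K : TrigPolyC4v} (hK : FrameOK (ctRenMs G) U (nScales β) μ K)
    {L M : ℕ} [NeZero L] [NeZero M] (hL : Lh ≤ L) (hM : Mh L ≤ M) {n : ℕ} (hn : n ≤ nScales β)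
    (hren : ∀ j < n, RenormalisedAtF L M β U μ K (ctRenMs G) j) :
    TwoLegSizesMS L M G Q (ctRenMs G) β U μ K n :=
  (hyp K hK L M hL hM n hn hren).2.1.2.1

/-- **The block yields (E3g) for renormalised frames** (angular regularity of the local part). -/
theorem CtHypMsE.twoLegAngularG (hyp : CtHypMsE E G P Q β U μ Lh Mh) {K : TrigPolyC4v} (hK : FrameOK (ctRenMs G) U (nScales β) μ K)
    {L M : ℕ} [NeZero L] [NeZero M] (hL : Lh ≤ L) (hM : Mh L ≤ M) {n : ℕ} (hn : n ≤ nScales β)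
    (hren : ∀ j < n, RenormalisedAtF L M β U μ K (ctRenMs G) j) :
    TwoLegAngularG L M G Q (ctRenMs G) β U μ K n :=
  (hyp K hK L M hL hM n hn hren).2.1.2.2.1

/-- **The block yields the (E3f) volume rate between two volumes carrying the renormalisation history**: if `K` is renormalised below `n` at
`(L, M)` and at `(L′, M′)`, `L ≤ L′`, both beyond the thresholds and the Matsubara thresholds `Q.M0`, then
`|ν_n^{L,M}(θ) − ν_n^{L′,M′}(θ)| ≤ Q.CL β n / L` at every angle. -/
theorem CtHypMsE.volumeRate (hyp : CtHypMsE E G P Q β U μ Lh Mh) {K : TrigPolyC4v} (hK : FrameOK (ctRenMs G) U (nScales β) μ K)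
    {L M : ℕ} [NeZero L] [NeZero M] (hL : Lh ≤ L) (hM : Mh L ≤ M) (hM0 : Q.M0 β L ≤ M) {L' M' : ℕ} [NeZero L'] [NeZero M']
    (hLL' : L ≤ L') (hM' : Mh L' ≤ M') (hM0' : Q.M0 β L' ≤ M') {n : ℕ} (hn : n ≤ nScales β)
    (hren : ∀ j < n, RenormalisedAtF L M β U μ K (ctRenMs G) j) (hren' : ∀ j < n, RenormalisedAtF L' M' β U μ K (ctRenMs G) j) (θ : ℝ) :
    |klLocalPart L M β U μ K n θ - klLocalPart L' M' β U μ K n θ| ≤ Q.CL β n / L :=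
  (hyp K hK L M hL hM n hn hren).2.1.2.2.2 hM0 L' M' hLL' hM0' (hyp.rateAntecedent hK (hL.trans hLL') hM' hn hren') θ

end AccessorsE

/-- **VOLUME TRANSFER, generic in the engine slot (PROVED).**  From the one-volume frame and the block: at every volume `(L, M)` with `L₀ ≤ L`,
`max (Mh L) (Q.M0 β L) ≤ M`, upward strong induction on `n` — the renormalisation of `K` at `(L, M)` below `n` gives, through the block, the
comparison antecedent there below `n` (`CtHypMsE.rateAntecedent`), which the (E3f) clause at the construction volume `(L₀, M₀)` consumes; so
`|ν_n^{L,M}| ≤ ½tol + Q.CL β n / L₀ ≤ tol`. -/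
theorem ct_volumeTransferMsE (E : EngSlot) (G : GeoConsts) (P : SplitConsts) (Q : EngConsts) (hG : G.WF) {β U μ : ℝ} {Lh : ℕ} {Mh : ℕ → ℕ}
    (hyp : CtHypMsE E G P Q β U μ Lh Mh) {K : TrigPolyC4v} (hK : FrameOK (ctRenMs G) U (nScales β) μ K) {L₀ M₀ : ℕ} [NeZero L₀] [NeZero M₀]
    (hL₀ : Lh ≤ L₀) (hM₀ : Mh L₀ ≤ M₀) (hM₀' : Q.M0 β L₀ ≤ M₀)
    (hhalf : ∀ n : ℕ, n ≤ nScales β →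
      (∀ θ : ℝ, |klLocalPart L₀ M₀ β U μ K n θ| ≤ ctCr G * |U| * klScale klE0 n ^ 2 / klE0 / 2) ∧
      Q.CL β n / L₀ ≤ ctCr G * |U| * klScale klE0 n ^ 2 / klE0 / 2) :
    ∀ (L M : ℕ) [NeZero L] [NeZero M], L₀ ≤ L → max (Mh L) (Q.M0 β L) ≤ M →
      ∀ n : ℕ, n ≤ nScales β → RenormalisedAtF L M β U μ K (ctRenMs G) n := by
  -- the half tolerance is nonnegative
  have htol_nonneg : ∀ n, 0 ≤ ctCr G * |U| * klScale klE0 n ^ 2 / klE0 / 2 := by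
    intro n
    have hS : ∀ j, 0 ≤ G.S j := hG.2.2.2.2.2.2.2.2.2.2.2.2.2.2.2.2.2.1
    have hcr : 0 ≤ ctCr G := by unfold ctCr; nlinarith [hS 0]
    have he0 : (0:ℝ) < klE0 := by norm_num [klE0]
    positivity
  -- renormalisation at the construction volume, at every scale (half tolerance ≤ tolerance)
  have hren0 : ∀ n, n ≤ nScales β → RenormalisedAtF L₀ M₀ β U μ K (ctRenMs G) n := by
    intro n hn θ
    have h := (hhalf n hn).1 θ
    show |klLocalPart L₀ M₀ β U μ K n θ| ≤ ctCr G * |U| * klScale klE0 n ^ 2 / klE0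
    linarith [htol_nonneg n]
  intro L M _ _ hL hM
  have hMh : Mh L ≤ M := (le_max_left _ _).trans hM
  have hM0 : Q.M0 β L ≤ M := (le_max_right _ _).trans hM
  -- strong induction on the scale at the target volume
  intro n
  induction n using Nat.strong_induction_on with
  | _ n ih =>
    intro hn θ
    have hrenL : ∀ j < n, RenormalisedAtF L M β U μ K (ctRenMs G) j := fun j hj =>
      ih j hj (le_of_lt (lt_of_lt_of_le hj hn))
    have hrate := hyp.volumeRate hK hL₀ hM₀ hM₀' hL hMh hM0 hn
      (fun j hj => hren0 j (le_of_lt (lt_of_lt_of_le hj hn))) hrenL θ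
    have hhalfθ := (hhalf n hn).1 θ
    have hCL := (hhalf n hn).2
    show |klLocalPart L M β U μ K n θ| ≤ ctCr G * |U| * klScale klE0 n ^ 2 / klE0
    have htri : |klLocalPart L M β U μ K n θ| ≤
        |klLocalPart L₀ M₀ β U μ K n θ| + |klLocalPart L₀ M₀ β U μ K n θ - klLocalPart L M β U μ K n θ| := by
      have h1 := abs_sub_abs_le_abs_sub (klLocalPart L M β U μ K n θ) (klLocalPart L₀ M₀ β U μ K n θ)
      rw [abs_sub_comm] at h1
      linarith
    linarith

/-- **COMPOSITION, generic in the engine slot: the counterterm child on the bundle `klPredsE E` follows from the one-volume construction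
`CtOneVolumeMsE E` alone** (for all well-formed constants) — the volume transfer is proved above; the renormalisation package is `ctRenMs G` (a
function of `G` alone), the common Matsubara threshold is `Mc L = max (Mh L) (Q.M0 β L)`.  At `E := EngineBoundsAtV7S` this is
`countertermP2_klPredsV11_of_ms` verbatim (`klPredsV11 = klPredsE EngineBoundsAtV7S` by `rfl`); at a future engine slot `E′` the counterterm child
`CountertermP2 (klPredsE E′) klWindowC` needs only `CtOneVolumeMsE E′`. -/
theorem countertermP2_klPredsE_of_ms (E : EngSlot) (hone : ∀ G P Q, G.WF → P.WF → Q.WF → CtOneVolumeMsE E G P Q) :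
    CountertermP2 (klPredsE E) klWindowC := by
  intro G P hG hP
  refine ⟨ctRenMs G, ctRenMs_WF2 hG, fun Q hQ => ?_⟩
  obtain ⟨c₁, hc₁, hc⟩ := hone G P Q hG hP hQ
  refine ⟨c₁, hc₁, fun c hc0 hcc => ?_⟩
  obtain ⟨U₀, hU₀, hmain⟩ := hc c hc0 hcc
  refine ⟨U₀, hU₀, fun μ hμ U hU hUle β hβ hβc Lh Mh hhyp => ?_⟩
  have hyp : CtHypMsE E G P Q β U μ Lh Mh := fun K hK L M _ _ hL hM n hn hren =>
    hhyp K hK L M hL hM n hn hren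
  obtain ⟨K, hK, L₀, M₀, hL₀pos, hM₀pos, hL₀, hM₀, hM₀', hhalf⟩ := hmain μ hμ U hU hUle β hβ hβc Lh Mh hyp
  haveI : NeZero L₀ := ⟨Nat.pos_iff_ne_zero.mp hL₀pos⟩
  haveI : NeZero M₀ := ⟨Nat.pos_iff_ne_zero.mp hM₀pos⟩
  refine ⟨K, hK, L₀, fun L => max (Mh L) (Q.M0 β L), fun L M _ _ hL hM n hn => ?_⟩
  exact ct_volumeTransferMsE E G P Q hG hyp hK hL₀ hM₀ hM₀' (hhalf inferInstance inferInstance) L M hL hM n hn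

/-- **The gen-3 composition recovered**: `countertermP2_klPredsV11_of_ms` is the `EngineBoundsAtV7S` instance of the generic composition. -/
theorem countertermP2_klPredsV11_of_ms' (hone : ∀ G P Q, G.WF → P.WF → Q.WF → CtOneVolumeMsE EngineBoundsAtV7S G P Q) :
    CountertermP2 klPredsV11 klWindowC :=
  countertermP2_klPredsE_of_ms EngineBoundsAtV7S hone

end Summit.HubbardSuperconductivity.HubbardSuperconductivity.Theorems.KLRegimeSplit

end
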